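/-
HONEST FRAMING: exact (Metropolis-corrected) sampling algorithms for lattice gauge theory; figures of merit
are autocorrelation/cost numbers at stated couplings and volumes; no continuum-physics claim.
-/
import Mathlib
import Summits.Ventures.LatticeQCDFlow.TrivializingMaps.GradedSeries
import Summits.Ventures.LatticeQCDFlow.TrivializingMaps.SlotCasimirGap

/-!
# Link masses of the graded Lüscher series (THEORY-1 §19, step (6a): the generation-level estimates)

Venture-side (`Summits/Ventures/LatticeQCDFlow/`), never `Literature/`.  For a generation `G` of rank-one
graded slot data (`GradedData.Gen`) the LINK MASS at a link `e` is
`N_G(e) = ∑_{i : c(mᵢ) ≠ 0} √((mᵢ)_e) · ‖zᵢ‖‖xᵢ‖‖yᵢ‖` (`Gen.mass`).  This file proves the estimates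
that make the graded series a mass-transfer process in the sense of the tree's `MassTransferContraction`:

* domination: `|∂^a_e G.func(ιU)| ≤ N_G(e)` on `SU(n)^E` (`Gen.abs_linkDeriv_func_le`), using that the
  coefficients of zero modes vanish (`gen0_z_eq_zero`, `Gen.step_z_eq_zero`);
* the Casimir/weight inequality `√(n/4) · ∑_e √(m_e) ≤ c(m)` and the gap `c(m) ≠ 0 ⇒ n/4 ≤ c(m)` for joint
  slot-Casimir modes (from `SlotCasimirGap.slotMode_gap`: every `m_e` is `0` or `≥ n/4`);
* modes vanish at links a slot system does not touch (`mode_eq_zero_of_forall_ne`);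
* a VOLUME-INDEPENDENT bound `τ_* = tauStar B` for the plaquette generator norms `∑_b genNorm` (the value of
  `genNorm (plaqIdx p) (polB b) B e` depends on `(p, e)` only through the pattern of slots pointing at `e`);
* the uniform shift constant `σ_* = shiftConst τ_* τ_*²` dominating every plaquette shift constant.

The step estimates (transferred amounts, emission, dead parents, off-plaquette links) are in
`GradedEmission.lean`.  All constants depend on `(n, B)` only.  0 sorry. [ours]
-/

namespace Summit.Ventures.LatticeQCDFlow.TrivializingMaps.GradedSeries

open scoped ComplexConjugate Matrix Matrix.Norms.Frobenius InnerProductSpace ContDiff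
open Finset
open Literature.MathematicalPhysics.QuantumFieldTheory
open Literature.MathematicalPhysics.QuantumFieldTheory.Luscher2010
open SlotRepresentation SlotCasimir SlotCoefficient SlotHilbert JointGrading CasimirGrading PlaquetteData
  SlotTensor TensorShift RankOne Vertex

variable {d L n : ℕ} [NeZero L]

/-! ## 1. Joint slot-Casimir modes: Casimir versus weights, gap, support -/

section Modes
variable {σ : Type*} [Fintype σ] [DecidableEq σ] (lnk : σ → Edge d L) (pol : σ → Bool) (B : SuBasis n)

/-- `√(n/4) · √(m_e) ≤ m_e` (each `m_e` is `0` or `≥ n/4`). [ours] -/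
theorem sqrt_quarter_mul_sqrt_mode_le (m : Modes (casimirFamily lnk pol B)) (e : Edge d L) :
    Real.sqrt ((n : ℝ) / 4) * Real.sqrt (m e : ℂ).re ≤ (m e : ℂ).re := by
  have h0 := slotMode_nonneg lnk pol B m e
  by_cases hn : n = 0
  · subst hn
    rw [Nat.cast_zero, zero_div, Real.sqrt_zero, zero_mul]
    exact h0
  rcases SlotCasimirGap.slotMode_gap B lnk pol hn m e with h | h
  · have h1 : (m e : ℂ).re = 0 := by rw [h]; simp
    rw [h1, Real.sqrt_zero, mul_zero]
  · calc Real.sqrt ((n : ℝ) / 4) * Real.sqrt (m e : ℂ).re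
        ≤ Real.sqrt (m e : ℂ).re * Real.sqrt (m e : ℂ).re :=
          mul_le_mul_of_nonneg_right (Real.sqrt_le_sqrt h) (Real.sqrt_nonneg _)
      _ = (m e : ℂ).re := Real.mul_self_sqrt h0

/-- **Casimir versus weights**: `√(n/4) · ∑_e √(m_e) ≤ c(m)`. [ours] -/
theorem sqrt_quarter_mul_sum_sqrt_le (m : Modes (casimirFamily lnk pol B)) :
    Real.sqrt ((n : ℝ) / 4) * ∑ e, Real.sqrt (m e : ℂ).re ≤ modeC lnk pol B m := by
  rw [modeC, Finset.mul_sum]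
  exact Finset.sum_le_sum fun e _ => sqrt_quarter_mul_sqrt_mode_le lnk pol B m e

/-- `m_e ≤ c(m)`. [ours] -/
theorem mode_re_le_modeC (m : Modes (casimirFamily lnk pol B)) (e : Edge d L) :
    (m e : ℂ).re ≤ modeC lnk pol B m := by
  rw [modeC]
  exact Finset.single_le_sum (fun e' _ => slotMode_nonneg lnk pol B m e') (Finset.mem_univ e)

/-- `√(m_e) ≤ √(c(m))`. [ours] -/
theorem sqrt_mode_le_sqrt_modeC (m : Modes (casimirFamily lnk pol B)) (e : Edge d L) :
    Real.sqrt (m e : ℂ).re ≤ Real.sqrt (modeC lnk pol B m) :=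
  Real.sqrt_le_sqrt (mode_re_le_modeC lnk pol B m e)

/-- **Gap**: `c(m) ≠ 0 ⇒ n/4 ≤ c(m)` (`n ≠ 0`). [ours] -/
theorem quarter_le_modeC (hn : n ≠ 0) (m : Modes (casimirFamily lnk pol B)) (h : modeC lnk pol B m ≠ 0) :
    (n : ℝ) / 4 ≤ modeC lnk pol B m := by
  by_contra hlt
  have hlt := lt_of_not_ge hlt
  apply h
  rw [modeC]
  refine Finset.sum_eq_zero fun e _ => ?_
  rcases SlotCasimirGap.slotMode_gap B lnk pol hn m e with h1 | h1
  · rw [h1]; simp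
  · exact absurd ((h1.trans (mode_re_le_modeC lnk pol B m e)).trans_lt hlt) (lt_irrefl _)

omit [NeZero L] in
/-- The slot generator vanishes at a link the system does not touch. [ours] -/
theorem slotGen_eq_zero_of_forall_ne {e : Edge d L} (he : ∀ s, lnk s ≠ e) (Y : Matrix (Fin n) (Fin n) ℂ) :
    slotGen lnk pol e Y = 0 := by
  rw [slotGen]; exact Finset.sum_eq_zero fun s _ => if_neg (he s)

omit [NeZero L] in
/-- … and so does its Hilbert-space version. [ours] -/
theorem genCLM_eq_zero_of_forall_ne {e : Edge d L} (he : ∀ s, lnk s ≠ e) (Y : Matrix (Fin n) (Fin n) ℂ) :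
    genCLM lnk pol e Y = 0 := by
  rw [genCLM, slotGen_eq_zero_of_forall_ne lnk pol he, toE_zero]

omit [NeZero L] in
/-- **Support**: a joint mode vanishes at a link the system does not touch. [ours] -/
theorem mode_eq_zero_of_forall_ne {e : Edge d L} (he : ∀ s, lnk s ≠ e)
    (m : Modes (casimirFamily lnk pol B)) : (m e : ℂ) = 0 := by
  obtain ⟨v, hv⟩ := Module.End.HasEigenvalue.exists_hasEigenvector
    (f := (casimirFamily lnk pol B e : SlotSpace σ n →ₗ[ℂ] SlotSpace σ n)) (m e).property
  have h1 : (casimirFamily lnk pol B e : SlotSpace σ n →ₗ[ℂ] SlotSpace σ n) v = (m e : ℂ) • v :=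
    hv.apply_eq_smul
  rw [ContinuousLinearMap.coe_coe] at h1
  have h0 : casimirM B lnk pol e = 0 := by
    rw [casimirM]; simp [slotGen_eq_zero_of_forall_ne lnk pol he]
  have hC : casimirFamily lnk pol B e v = 0 := by
    show toE (casimirM B lnk pol e) v = 0
    rw [h0, toE_zero]; rfl
  rw [hC] at h1
  exact (smul_eq_zero.1 h1.symm).resolve_right hv.2

end Modes

/-! ## 2. A volume-independent bound for the plaquette generator norms -/

section Tau
variable (B : SuBasis n)

/-- `τ_* = ∑_{f : Fin 4 → Bool} ∑_b ∑_a ‖∑_{s : f s} ins_s (T_a^{±})‖`: dominates every plaquette generator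
norm, whatever the plaquette and the link (depends on `n, B` only). [ours] -/
noncomputable def tauStar : ℝ :=
  ∑ f : Fin 4 → Bool, ∑ b : Bool, ∑ a : B.ι,
    ‖toE (∑ s : Fin 4, if f s = true then ins s (polM (polB b s) (B.T a)) else 0)‖

/-- `τ_* ≥ 0`. [ours] -/
theorem tauStar_nonneg : 0 ≤ tauStar B := by unfold tauStar; positivity

omit [NeZero L] in
/-- The slot generator of a 4-slot system through the pattern of slots at `e`. [ours] -/
theorem slotGen_eq_pattern (lnk : Fin 4 → Edge d L) (b : Bool) (e : Edge d L)
    (Y : Matrix (Fin n) (Fin n) ℂ) :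
    slotGen lnk (polB b) e Y
      = ∑ s : Fin 4, if (fun s => decide (lnk s = e)) s = true then ins s (polM (polB b s) Y) else 0 := by
  rw [slotGen]
  refine Finset.sum_congr rfl fun s _ => ?_
  simp only [decide_eq_true_eq]

omit [NeZero L] in
/-- `∑_b τ_e(Q_{p,b}) ≤ τ_*` for every 4-slot system and every link. [ours] -/
theorem sum_genNorm_le_tauStar (lnk : Fin 4 → Edge d L) (e : Edge d L) :
    ∑ b, genNorm lnk (polB b) B e ≤ tauStar B := by
  have hterm : ∀ b, genNorm lnk (polB b) B e = ∑ a : B.ι,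
      ‖toE (∑ s : Fin 4, if (fun s => decide (lnk s = e)) s = true
        then ins s (polM (polB b s) (B.T a)) else 0)‖ := fun b => by
    unfold genNorm
    refine Finset.sum_congr rfl fun a _ => ?_
    rw [genCLM, slotGen_eq_pattern]
  simp only [hterm]
  unfold tauStar
  exact Finset.single_le_sum (s := Finset.univ)
    (f := fun f : Fin 4 → Bool => ∑ b : Bool, ∑ a : B.ι,
      ‖toE (∑ s : Fin 4, if f s = true then ins s (polM (polB b s) (B.T a)) else 0)‖)
    (fun f _ => by positivity) (Finset.mem_univ _)

omit [NeZero L] in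
/-- `τ_e(Q_{p,b}) ≤ τ_*`. [ours] -/
theorem genNorm_le_tauStar (lnk : Fin 4 → Edge d L) (b : Bool) (e : Edge d L) :
    genNorm lnk (polB b) B e ≤ tauStar B :=
  le_trans (Finset.single_le_sum (f := fun b => genNorm lnk (polB b) B e)
    (fun _ _ => genNorm_nonneg _ _ _ _) (Finset.mem_univ b)) (sum_genNorm_le_tauStar B lnk e)

/-- `shiftConst` is monotone (`τ ≥ 0`). [ours] -/
theorem shiftConst_mono {τ τ' cb cb' : ℝ} (hτ0 : 0 ≤ τ) (hτ : τ ≤ τ') (hcb : cb ≤ cb') :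
    shiftConst τ cb ≤ shiftConst τ' cb' := by
  unfold shiftConst
  have : τ ^ 2 ≤ τ' ^ 2 := pow_le_pow_left₀ hτ0 hτ 2
  exact add_le_add hτ (Real.sqrt_le_sqrt (by linarith))

/-- The uniform shift constant `σ_* = shiftConst τ_* τ_*²`. [ours] -/
noncomputable def sigmaStar : ℝ := shiftConst (tauStar B) (tauStar B ^ 2)

/-- `σ_* ≥ 0`. [ours] -/
theorem sigmaStar_nonneg : 0 ≤ sigmaStar B := shiftConst_nonneg (tauStar_nonneg B)

omit [NeZero L] in
/-- The plaquette shift constants are `≤ σ_*`. [ours] -/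
theorem shiftConst_genNorm_le (lnk : Fin 4 → Edge d L) (b : Bool) (e : Edge d L) :
    shiftConst (genNorm lnk (polB b) B e) (genNorm lnk (polB b) B e ^ 2) ≤ sigmaStar B :=
  shiftConst_mono (genNorm_nonneg _ _ _ _) (genNorm_le_tauStar B lnk b e)
    (pow_le_pow_left₀ (genNorm_nonneg _ _ _ _) (genNorm_le_tauStar B lnk b e) 2)

end Tau

/-! ## 3. Link masses of a generation; domination of the gradients -/

namespace Gen
variable {B : SuBasis n} {σ : Type} [Fintype σ] [DecidableEq σ] (G : Gen (d := d) (L := L) B σ)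

/-- The mass of datum `i`: `νᵢ = ‖zᵢ‖‖xᵢ‖‖yᵢ‖`. [ours] -/
noncomputable def nu (i : G.I) : ℝ := ‖G.z i‖ * (‖G.x i‖ * ‖G.y i‖)

omit [NeZero L] in
/-- `νᵢ ≥ 0`. [ours] -/
theorem nu_nonneg (i : G.I) : 0 ≤ G.nu i := by unfold nu; positivity

/-- The link weight of datum `i`: `√((mᵢ)_e)`. [ours] -/
noncomputable def wt (i : G.I) (e : Edge d L) : ℝ := Real.sqrt ((G.m i e : ℂ).re)

omit [NeZero L] in
/-- `wt ≥ 0`. [ours] -/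
theorem wt_nonneg (i : G.I) (e : Edge d L) : 0 ≤ G.wt i e := Real.sqrt_nonneg _

/-- The live data: `c(mᵢ) ≠ 0`. [ours] -/
noncomputable def live : Finset G.I := Finset.univ.filter fun i => G.cm i ≠ 0

/-- Membership in `live`. [ours] -/
theorem mem_live {i : G.I} : i ∈ G.live ↔ G.cm i ≠ 0 := by simp [live]

/-- The LINK MASS `N_G(e) = ∑_{i live} √((mᵢ)_e) νᵢ`. [ours] -/
noncomputable def mass (e : Edge d L) : ℝ := ∑ i ∈ G.live, G.wt i e * G.nu i

/-- `N_G(e) ≥ 0`. [ours] -/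
theorem mass_nonneg (e : Edge d L) : 0 ≤ G.mass e :=
  Finset.sum_nonneg fun i _ => mul_nonneg (G.wt_nonneg i e) (G.nu_nonneg i)

omit [NeZero L] in
/-- `|∂^a_e termᵢ(ιU)| ≤ √((mᵢ)_e) νᵢ`. [ours] -/
theorem abs_linkDeriv_term_le (i : G.I) (e : Edge d L) (a : B.ι)
    (U : GaugeConfig d L (Matrix.specialUnitaryGroup (Fin n) ℂ)) :
    |linkDeriv e (B.T a) (G.term i) (WilsonFlow.coeConfig U)| ≤ G.wt i e * G.nu i := by
  have h := abs_linkDeriv_termF_coeConfig_le (G.lnk i) (G.pol i) (G.z i) (G.x i) B (G.m i) (G.v i) e a U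
  refine (le_of_eq rfl).trans (h.trans (le_of_eq ?_))
  unfold wt nu Gen.y
  ring

/-- **Domination**: if dead data carry no coefficient, `|∂^a_e G.func(ιU)| ≤ N_G(e)`. [ours] -/
theorem abs_linkDeriv_func_le (hz : ∀ i, G.cm i = 0 → G.z i = 0) (e : Edge d L) (a : B.ι)
    (U : GaugeConfig d L (Matrix.specialUnitaryGroup (Fin n) ℂ)) :
    |linkDeriv e (B.T a) G.func (WilsonFlow.coeConfig U)| ≤ G.mass e := by
  rw [G.linkDeriv_func]
  refine (Finset.abs_sum_le_sum_abs _ _).trans ?_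
  have h1 : ∑ i, |linkDeriv e (B.T a) (G.term i) (WilsonFlow.coeConfig U)| ≤ ∑ i, G.wt i e * G.nu i :=
    Finset.sum_le_sum fun i _ => G.abs_linkDeriv_term_le i e a U
  refine h1.trans (le_of_eq ?_)
  unfold mass live
  rw [Finset.sum_filter_of_ne]
  intro i _ hi hc
  apply hi
  have : G.nu i = 0 := by unfold nu; rw [hz i hc, norm_zero, zero_mul]
  rw [this, mul_zero]

/-- Casimir versus weights for a datum: `√(n/4) ∑_e wt i e ≤ c(mᵢ)`. [ours] -/
theorem sqrt_quarter_mul_sum_wt_le (i : G.I) : Real.sqrt ((n : ℝ) / 4) * ∑ e, G.wt i e ≤ G.cm i :=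
  sqrt_quarter_mul_sum_sqrt_le (G.lnk i) (G.pol i) B (G.m i)

/-- Gap for a live datum: `n/4 ≤ c(mᵢ)`. [ours] -/
theorem quarter_le_cm (hn : n ≠ 0) {i : G.I} (hi : i ∈ G.live) : (n : ℝ) / 4 ≤ G.cm i :=
  quarter_le_modeC (G.lnk i) (G.pol i) B hn (G.m i) (G.mem_live.1 hi)

/-- `c(mᵢ) ≥ 0`. [ours] -/
theorem cm_nonneg (i : G.I) : 0 ≤ G.cm i := modeC_nonneg (G.lnk i) (G.pol i) B (G.m i)

end Gen

/-! ## 4. Dead data carry no coefficient -/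

section Dead
variable (B : SuBasis n)

/-- Generation 0: `c(m) = 0 ⇒ z = 0`. [ours] -/
theorem gen0_z_eq_zero (j : (gen0 (d := d) (L := L) B).I) (h : (gen0 (d := d) (L := L) B).cm j = 0) :
    (gen0 (d := d) (L := L) B).z j = 0 := by
  have h' : modeC (plaqIdx (d := d) (L := L) j.1.1.1 j.1.1.2.1 j.1.1.2.2) plaqPol B j.2 = 0 := h
  show (if j.1.1.2.1 < j.1.1.2.2
    then zneg (modeC (plaqIdx (d := d) (L := L) j.1.1.1 j.1.1.2.1 j.1.1.2.2) plaqPol B j.2) else 0) = 0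
  rw [h']
  simp [zneg]

variable {B} {σ : Type} [Fintype σ] [DecidableEq σ] (G : Gen (d := d) (L := L) B σ)

/-- The step: `c(m') = 0 ⇒ z = 0`. [ours] -/
theorem Gen.step_z_eq_zero (j : G.CIdx) (h : G.step.cm j = 0) : G.step.z j = 0 := by
  have h' : modeC (G.clnk j.2.2.1 j.2.2.2.1) (G.cpol j.2.2.1 j.2.2.2.2.1) B j.2.2.2.2.2.2 = 0 := h
  show zdiv (modeC (G.clnk j.2.2.1 j.2.2.2.1) (G.cpol j.2.2.1 j.2.2.2.2.1) B j.2.2.2.2.2.2)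
    (G.zhalf j.2.2.1 j.2.2.2.1) = 0
  rw [h']
  simp [zdiv]

end Dead

end Summit.Ventures.LatticeQCDFlow.TrivializingMaps.GradedSeries
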